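import Mathlib

/-!
# Polynomial interpolation on a statistic with level-`k` powers (stub `stub_polyOfLevels`)

Line `SketchIdeator3G2` (radial branch) for the crux `LevelGradedCohnUmans.SubgroupIdentityDesigns`
(`stmt-MatrixMultiplication-14079`).

A function `f : GL_m(𝔽_p) → ℂ` has *Fourier level* `≤ k` if `f(g) = Σ_M c_M ψ(tr(M g))`
(`ψ = ZMod.stdAddChar`, `M` ranging over `M_m(𝔽_p)`) with a coefficient table `c` vanishing on
matrices of rank `> k`.  Let `x : GL_m(𝔽_p) → ℂ` be a statistic all of whose powers `x^j`
(`j ≤ k`) have level `≤ k`, and let `R ⊂ ℂ` be a set of at most `k` "forbidden values" with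
`x 1 ∉ R`.  Put `P(X) = Π_{r ∈ R} (X - r)`, a polynomial of degree `|R| ≤ k` vanishing on `R` with
`P(x 1) ≠ 0`, and `f(g) = P(x g) / P(x 1)`.  Writing `P(y) = Σ_{j ≤ k} P_j y^j`
(`Polynomial.eval_eq_sum_range'`) and expanding each power `x^j` with its level-`k` table `c_j`,
`f` is expanded with the table `c_M = P(x 1)⁻¹ Σ_{j ≤ k} P_j c_{j,M}`, which again vanishes above
rank `k`; and `f(1) = 1`, `f(g) = 0` whenever `x g ∈ R`.
-/

-- single-conjunct summit: namespace repeats MatrixMultiplication (summit = sub-problem)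
set_option linter.dupNamespace false

noncomputable section

open scoped BigOperators Classical

namespace Summit.MatrixMultiplication.MatrixMultiplication.Theorems.Witnessed

variable {p m : ℕ} [Fact p.Prime]

/-- **Polynomial interpolation on a statistic whose powers have level `≤ k`** (stub
`stub_polyOfLevels`).  If `x : GL_m(𝔽_p) → ℂ` has all powers `x^j` (`j ≤ k`) of Fourier level
`≤ k` (expansions `Σ_M c_M ψ(tr(M g))`, `ψ = ZMod.stdAddChar`, with coefficients vanishing above
rank `k`), and `R` is a set of at most `k` values not containing `x 1`, then some level-`k` function
is `1` at the identity and `0` wherever `x g ∈ R`: namely `P(x g) / P(x 1)` for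
`P(X) = Π_{r ∈ R} (X - r)`, expanded in the powers `x^j`. -/
theorem stub_polyOfLevels {k : ℕ} (x : Matrix.GeneralLinearGroup (Fin m) (ZMod p) → ℂ)
    (hx : ∀ j : ℕ, j ≤ k → ∃ c : Matrix (Fin m) (Fin m) (ZMod p) → ℂ, (∀ M, k < M.rank → c M = 0) ∧
      ∀ g : Matrix.GeneralLinearGroup (Fin m) (ZMod p), x g ^ j =
        ∑ M : Matrix (Fin m) (Fin m) (ZMod p),
          c M * ZMod.stdAddChar (Matrix.trace (M * (g : Matrix (Fin m) (Fin m) (ZMod p)))))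
    (R : Finset ℂ) (hR : R.card ≤ k) (h1 : x 1 ∉ R) :
    ∃ c : Matrix (Fin m) (Fin m) (ZMod p) → ℂ, (∀ M, k < M.rank → c M = 0) ∧
      (∑ M : Matrix (Fin m) (Fin m) (ZMod p), c M * ZMod.stdAddChar (Matrix.trace
          (M * ((1 : Matrix.GeneralLinearGroup (Fin m) (ZMod p)) : Matrix (Fin m) (Fin m) (ZMod p))))) = 1 ∧
      ∀ g : Matrix.GeneralLinearGroup (Fin m) (ZMod p), x g ∈ R →
        (∑ M : Matrix (Fin m) (Fin m) (ZMod p),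
          c M * ZMod.stdAddChar (Matrix.trace (M * (g : Matrix (Fin m) (Fin m) (ZMod p))))) = 0 := by
  -- the interpolating polynomial `P = Π_{r ∈ R} (X - r)`: degree `≤ k`, `P(x 1) ≠ 0`, `P|_R = 0`
  obtain ⟨P, hPdeg, hP1, hP0⟩ : ∃ P : Polynomial ℂ, P.natDegree ≤ k ∧ P.eval (x 1) ≠ 0 ∧
      ∀ y ∈ R, P.eval y = 0 := by
    refine ⟨∏ r ∈ R, (Polynomial.X - Polynomial.C r), ?_, ?_, ?_⟩
    · refine (Polynomial.natDegree_prod_le _ _).trans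
        ((Finset.sum_le_sum fun r _ => Polynomial.natDegree_X_sub_C_le r).trans ?_)
      simpa using hR
    · rw [Polynomial.eval_prod]
      refine Finset.prod_ne_zero_iff.mpr fun r hr => ?_
      rw [Polynomial.eval_sub, Polynomial.eval_X, Polynomial.eval_C]
      exact sub_ne_zero.mpr fun h => h1 (by rwa [h])
    · intro y hy
      rw [Polynomial.eval_prod]
      exact Finset.prod_eq_zero hy
        (by rw [Polynomial.eval_sub, Polynomial.eval_X, Polynomial.eval_C, sub_self])
  -- `P(y) = Σ_{j ≤ k} P_j y^j`
  have hPeval : ∀ y : ℂ, P.eval y = ∑ j ∈ Finset.range (k + 1), P.coeff j * y ^ j :=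
    fun y => Polynomial.eval_eq_sum_range' (Nat.lt_succ_of_le hPdeg) y
  -- the level-`k` tables `c j` of the powers `x^j`, `j ≤ k`
  choose! c hc hxc using hx
  -- linearity: the combined table expands `P(x g) / P(x 1)`
  have key : ∀ g : Matrix.GeneralLinearGroup (Fin m) (ZMod p),
      (∑ M : Matrix (Fin m) (Fin m) (ZMod p),
        ((P.eval (x 1))⁻¹ * ∑ j ∈ Finset.range (k + 1), P.coeff j * c j M) *
          ZMod.stdAddChar (Matrix.trace (M * (g : Matrix (Fin m) (Fin m) (ZMod p))))) =
        (P.eval (x 1))⁻¹ * P.eval (x g) := by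
    intro g
    rw [hPeval (x g)]
    have e : ∑ j ∈ Finset.range (k + 1), P.coeff j * x g ^ j =
        ∑ j ∈ Finset.range (k + 1), P.coeff j * ∑ M : Matrix (Fin m) (Fin m) (ZMod p),
          c j M * ZMod.stdAddChar (Matrix.trace (M * (g : Matrix (Fin m) (Fin m) (ZMod p)))) :=
      Finset.sum_congr rfl fun j hj => by
        rw [hxc j (Nat.lt_succ_iff.mp (Finset.mem_range.mp hj)) g]
    rw [e]
    simp only [Finset.mul_sum, Finset.sum_mul, mul_assoc]
    exact Finset.sum_comm
  refine ⟨fun M => (P.eval (x 1))⁻¹ * ∑ j ∈ Finset.range (k + 1), P.coeff j * c j M, ?_, ?_, ?_⟩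
  · -- support: every `c j` (`j ≤ k`) vanishes above rank `k`, hence so does the combination
    intro M hM
    have h0 : ∑ j ∈ Finset.range (k + 1), P.coeff j * c j M = 0 :=
      Finset.sum_eq_zero fun j hj => by
        rw [hc j (Nat.lt_succ_iff.mp (Finset.mem_range.mp hj)) M hM, mul_zero]
    simp only [h0, mul_zero]
  · -- value at the identity: `P(x 1)⁻¹ P(x 1) = 1`
    exact (key 1).trans (inv_mul_cancel₀ hP1)
  · -- vanishing on the forbidden values: `P(x g) = 0` for `x g ∈ R`
    intro g hg
    rw [key g, hP0 _ hg, mul_zero]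

end Summit.MatrixMultiplication.MatrixMultiplication.Theorems.Witnessed

end
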